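import Summits.BirchSwinnertonDyer.BirchSwinnertonDyer.Theorems.KimAtThreeFineKatoLemmaL
import Summits.BirchSwinnertonDyer.BirchSwinnertonDyer.Theorems.KimAtThreePortSharedSATCore
import Summits.BirchSwinnertonDyer.Rank1Residual.GaloisImage.KatoKuriharaPortThreeOfZetaBody
import HarnessLib

/-!
# The (P-EXP) rider `KatoExpStarFiniteLevelAt W 3 j 0 v₃ Λ Λfin_j` ASSEMBLED at every depth — `Λfin`
# CONSTRUCTED, clause (i) PROVED, clause (ii) GLUED to the scalar core of SAT₀ — and the registered stub
# `stub_fineKato` (= ⟨C1⟩, crux `KatoKuriharaPortThreeShared`, stmt-BirchSwinnertonDyer-19560) from ONE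
# displayed «defined-Kato package» with NO rider predicate left in it
# (cell `bsd-addord`, seat kim3 gen 13; route W2 `KimAtThreeKolyvagin`; `--supports 19560`, helper)

HONEST FRAMING. TOOL theorems only (no definition, no named fact, no `sorry`); closes nothing;
nothing is booked; BSD is not proved by any of this.  Inputs BY NAME: this seat's
`KimAtThreeFineKatoLemmaL.exists_finLevelFunctional_clauses_three` (p490100: `Λfin_j` constructed from
an abstract integral `exp*_ω = φ` at `ℚ₃`, clause (i) + the interface `Λfin_j(π_{j+1,*} y) = exp*_ω(y)
mod 3^{j+1}`, modulo the displayed ℚ₃-level print facts `hker` = [BK90] 3.8/3.11 and `hdual` = Tate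
duality in lattice form) and w2-acc4's `KimAtThreePortSharedSATCore.toZModPow_eq_of_rider_premise`
(p477821: the scalar core of LEMMA SAT₀ over `ℚ₃ ⊗ ℚ(ζ_m)` with `L_int = cycIntLattice`).  What stays
DISPLAYED is exactly the `exp*`-side that the tree cannot yet construct, as statements about the
abstract data `(Λ, φ)` — no `Λfin`, no `KatoExpStarFiniteLevelAt`:

* the **semi-local package** at depth `j` and tame level `r` (`m = cycLevel 3 0 r`,
  semi-local algebra `ℚ₃ ⊗_ℚ ℚ(ζ_m) = ∏_{𝔓∣3} K_𝔓`, `K_𝔓/ℚ₃` UNRAMIFIED): a set `Λ₀ ⊆ L_int(m)` with an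
  element of unit trace (SAT₀'s E-side `Λ₀ = log_ω E₀(K_𝔓)`: kim3 memo KIM3-W2-C1-g11 §2.4 (β)(γ)(δ) — the
  `K_w` formal-group / logarithm port of seats w2-acc4 / w2-kport), a `ℤ₃`-submodule `M` with
  `Tr(M·Λ₀) ⊆ ℤ₃` (the semi-local `exp*_ω`-lattice, `M ⊆ Λ₀^∨`: [BK90] 3.8 + duality over `K_𝔓`), and
  the **COMPAT clause**: for `h ∈ H¹(ℚ_{v₃}, T₃W)` with `π_{j+1,*} h = loc_{v₃} κ₀` and `res κ₀ = Ψ y`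
  (the derivative-class shape of clause (ii)), `φ(h) ⊗ 1 − 3⁰·Λ_{0,r}(y) ∈ 3^{j+1}·M` — for Kato's
  witnesses this is "`res_{K_𝔓} h − loc_𝔓 y ∈ ker(H¹(K_𝔓,T) → H¹(K_𝔓,E[M])) = M·H¹(K_𝔓,T)` and `exp*`
  commutes with restriction" (memo §2.4 "(C1.c) from SAT₀"), which needs `Λ := (exp*_ω ∘ loc_𝔓)_𝔓`
  DEFINED (Kato-v2, `EulerSystemValues.lean` TODO) and the local Galois cohomology of the `K_𝔓`;
* in `fineKato_of_definedKatoPackage` additionally: (R-κ) `κ ∈ ℚˣ, v₃(κ) = 0` ((C1.a) ⟸ `3 ∤ c_P`,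
  memo (a″)), `hker`/`hdual` for `φ`, and Kato's `ZetaBody` family for `(ι, κ, Λ)` ([Kato04] (8.1.3),
  8.12, 9.7, 6.6 (1), 13.3 = the tree's `Kato2004.exists_eulerSystem_expStar_values` once `Λ` is defined).

## What is proved

* `exists_katoExpStarFiniteLevelAt_of_semiLocal` — on a Kato-stratum row, from `φ` + `hker` + `hdual` +
  the semi-local package for `(Λ, φ)`: **`∃ Λfin, (∀ j, KatoExpStarFiniteLevelAt W 3 j 0 v₃ Λ (Λfin j))`**
  (the FULL rider — (i-a), (i-b) from p490100; (ii): lift `loc_{v₃} κ₀` to `h` (`𝓕_can`), `Λfin_j(loc κ₀)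
  = exp*_ω(h) mod 3^{j+1}` by the interface, COMPAT gives the `exp*`-side input of SAT₀, and
  `toZModPow_eq_of_rider_premise` turns the premise `3⁰Λ_{0,r}(y) ≡ s ⊗ 1 (mod 3^{j+1}L_int)` into
  `exp*_ω(h) ≡ s`) ∧ the interface.
* `fineKato_of_definedKatoPackage` — **the registered stub `stub_fineKato`'s signature VERBATIM** (⟨C1⟩:
  `∃ (ι, κ, Λ, Λfin), κ ≠ 0 ∧ R-κ ∧ (∀ j, rider) ∧ ZetaBody-family`) from the displayed defined-Kato
  package `hK` (per row: `∃ (ι, κ, Λ, φ)`, R-κ ∧ hker ∧ hdual ∧ semi-local package ∧ ZetaBody-family).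
  Reading for the route's residual: **19560 ⟸ ⟨C1⟩ ⟸ hK**, where `hK` speaks only of `exp*_ω` (over `ℚ₃`
  and the unramified `K_𝔓`), the `K_𝔓` formal-group logarithm, Kato's constant and Kato's system — the
  rider's finite-level functional and both its clauses are now kernel constructions/theorems.

References: S. Bloch, K. Kato (1990) §3 [BlochKato1990]; K. Kato, Astérisque 295 (2004) §8.1, 8.12, §9.4,
Thm. 9.7, Thm. 6.6, Ex. 13.3 [Kato2004Asterisque]; C.-H. Kim, AJM 148 (2026) §3.3–§3.4.1, Thm. 3.13
[Kim2022StructureSelmer]; C.-H. Kim, K. Nakamura, JNT 210 (2020) Thm. 2.1 / Cor. 2.4 [KimNakamura2020];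
n1011 ROUTE-1 §53.3–§53.4 (LEMMA SAT, D-53-1 … D-53-7); kim3 memos KIM3-W2-C1-g11 §2, KIM3-W2-C1-SIZING-g12.
-/

noncomputable section

-- the cell's Theorems namespace `Summit.BirchSwinnertonDyer.BirchSwinnertonDyer.…` repeats the summit name by design (D-0017)
set_option linter.dupNamespace false

open scoped Classical NumberField TensorProduct ContRepresentation
open Field NumberField IsDedekindDomain
open WeierstrassCurve Literature.NumberTheory.EllipticCurves Literature.NumberTheory.GaloisRepresentations
  Literature.NumberTheory.GaloisRepresentations.DiscreteGaloisModule Literature.NumberTheory.GaloisCohomology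
open Literature.NumberTheory.EllipticCurves.ModularForms Literature.NumberTheory.EllipticCurves.Rank1Residual
open Literature.NumberTheory.EllipticCurves.Kato2004 Literature.NumberTheory.EllipticCurves.Kato2004.EulerSystemValues
open Summit.BirchSwinnertonDyer.Rank1Residual.GaloisImage
open Summit.BirchSwinnertonDyer.Rank1Residual.Additive.LocalLog
open Summit.BirchSwinnertonDyer.BirchSwinnertonDyer.Theorems

namespace Summit.BirchSwinnertonDyer.BirchSwinnertonDyer.Theorems.KimAtThreeFineKatoRiderAssembly

variable (W : WeierstrassCurve ℚ) [W.IsElliptic] [W.IsGloballyMinimal] [ContinuousSMul ℤ_[3] (W.tateModule 3)]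

/-- **The FULL (P-EXP) rider `KatoExpStarFiniteLevelAt W 3 j 0 v₃ Λ Λfin_j` at EVERY depth, with
`Λfin` CONSTRUCTED**, on a Kato-stratum row (`Addv W 3`, `3 ∤ c₃`, `#E(ℚ₃)[3] = 1`, `v₃ ∣ 3`), from:
(a) an abstract scalar dual exponential `φ = exp*_ω : H¹(ℚ_{v₃}, T₃W) →+ ℚ₃` with the two ℚ₃-level
PRINT facts `hker` ([BK90] 3.8/3.11: kernel = `H¹_f`) and `hdual` (Tate duality: range = `(log_ω E(ℚ₃))^∨`)
displayed — giving clause (i) and the interface by `KimAtThreeFineKatoLemmaL`; and (b) a DISPLAYED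
SEMI-LOCAL PACKAGE for Kato's value datum `Λ` at each depth `j` and tame level `r` (`m = cycLevel 3 0 r`):
a set `Λ₀ ⊆ L_int(m)` with a trace-unimodular element (SAT₀'s E-side over the unramified `K_w/ℚ₃`:
`Λ₀ = log_ω E₀`, kim3 memo KIM3-W2-C1-g11 §2.4 (β)(γ)(δ)), a `ℤ₃`-submodule `M ⊆ Λ₀^∨` (the semi-local
`exp*_ω`-lattice, [BK90] 3.8 + duality over `K_w`), and the COMPATIBILITY clause tying `Λ_{0,r}` to `φ`:
whenever `h ∈ H¹(ℚ_{v₃}, T₃W)` lifts `loc_{v₃} κ₀` and `res κ₀ = Ψ y`, `φ(h) ⊗ 1 − 3⁰·Λ_{0,r}(y) ∈ 3^{j+1}·M`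
(exactness over each `K_𝔓` + restriction-compatibility of `exp*` + `Λ := (exp*_ω ∘ loc_𝔓)_𝔓` DEFINED,
i.e. Kato-v2).  Clause (ii) is then w2-acc4's scalar core `KimAtThreePortSharedSATCore.toZModPow_eq_of_rider_premise`.
Conclusion: `∃ Λfin, (∀ j, KatoExpStarFiniteLevelAt W 3 j 0 v₃ Λ (Λfin j)) ∧ interface`.  Nothing about
`exp*` is constructed; closes nothing.
[cite: Kim2022StructureSelmer, §3.3 (Lemma 3.11, Prop. 3.12), §3.4.1 and the proof of Thm. 3.13 (arXiv v3 pp. 26–27)]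
[cite: BlochKato1990, §3 (Prop. 3.8, Ex. 3.11)] [cite: KimNakamura2020, Thm. 2.1 and Cor. 2.4] -/
theorem exists_katoExpStarFiniteLevelAt_of_semiLocal (hadd : Addv W 3)
    (hc : ¬ 3 ∣ (W.baseChange ℚ_[3]).localTamagawaNumber ℤ_[3])
    (ht : Nat.card {Q : (W.baseChange ℚ_[3]).toAffine.Point // (3 : ℕ) • Q = 0} = 1)
    (v₃ : HeightOneSpectrum (𝓞 ℚ)) (hv₃ : ((3 : ℕ) : 𝓞 ℚ) ∈ v₃.asIdeal)
    (φ : (tateLocalRep W 3 (Sum.inr v₃)).cohomology 1 →+ ℚ_[3])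
    (hker : ∀ y, φ y = 0 ↔ ∀ j : ℕ, tateLocalMap W 3 j (Sum.inr v₃) y ∈
      W.kummerSelmerStructure (((3 : ℕ) : ℤ) ^ j * ((3 : ℕ) : ℤ)) (Sum.inr v₃))
    (hdual : ∀ a : ℚ_[3], (∃ y, φ y = a) ↔
      ∀ P : (W.baseChange ℚ_[3]).toAffine.Point, ‖a * padicLog (W.baseChange ℚ_[3]) P‖ ≤ 1)
    (Λ : ∀ (k' : ℕ) (r : Finset (HeightOneSpectrum (𝓞 ℚ))),
      H1 (tateRep W 3) (cycSubgroup 3 k' r) →ₗ[ℤ_[3]] ℚ_[3] ⊗[ℚ] CyclotomicField (cycLevel 3 k' r) ℚ)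
    (hsemi : ∀ (j : ℕ) (r : Finset (HeightOneSpectrum (𝓞 ℚ))),
      ∃ (Λ₀ : Set (ℚ_[3] ⊗[ℚ] CyclotomicField (cycLevel 3 0 r) ℚ))
        (M : Submodule ℤ_[3] (ℚ_[3] ⊗[ℚ] CyclotomicField (cycLevel 3 0 r) ℚ)),
        Λ₀ ⊆ cycIntLattice 3 (cycLevel 3 0 r) ∧
        (∃ ℓ ∈ Λ₀, ‖Algebra.trace ℚ_[3] (ℚ_[3] ⊗[ℚ] CyclotomicField (cycLevel 3 0 r) ℚ) ℓ‖ = 1) ∧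
        (∀ μ ∈ M, ∀ ℓ ∈ Λ₀,
          ‖Algebra.trace ℚ_[3] (ℚ_[3] ⊗[ℚ] CyclotomicField (cycLevel 3 0 r) ℚ) (μ * ℓ)‖ ≤ 1) ∧
        ∀ (Ψ : H1 (tateRep W 3) (cycSubgroup 3 0 r) →+
            continuousCohomology 1 (subgroupRep
              (W.torsionGaloisModule (((3 : ℕ) : ℤ) ^ j * ((3 : ℕ) : ℤ))).toTopRep (cycSubgroup 3 0 r))),
          (∀ (φ' : contOneCocycles (subgroupRep (tateRep W 3).toTopRep (cycSubgroup 3 0 r)))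
              (ψ : contOneCocycles (subgroupRep
                (W.torsionGaloisModule (((3 : ℕ) : ℤ) ^ j * ((3 : ℕ) : ℤ))).toTopRep (cycSubgroup 3 0 r))),
              (∀ g, ((ψ.1 g : geomTorsion W (((3 : ℕ) : ℤ) ^ j * ((3 : ℕ) : ℤ))) : geomPoints W) =
                TateModule.proj 3 (j + 1) (φ'.1 g)) →
              Ψ (oneCocycleClass _ φ') = oneCocycleClass _ ψ) →
          ∀ (y : H1 (tateRep W 3) (cycSubgroup 3 0 r))
            (κ₀ : galoisCohomology (W.torsionGaloisModule (((3 : ℕ) : ℤ) ^ j * ((3 : ℕ) : ℤ))) 1)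
            (h : (tateLocalRep W 3 (Sum.inr v₃)).cohomology 1),
            resSubgroup (W.torsionGaloisModule (((3 : ℕ) : ℤ) ^ j * ((3 : ℕ) : ℤ))).toTopRep
                (cycSubgroup 3 0 r) 1 κ₀ = Ψ y →
            galoisCohomology.localization (W.torsionGaloisModule (((3 : ℕ) : ℤ) ^ j * ((3 : ℕ) : ℤ)))
                (Sum.inr v₃) 1 κ₀ = tateLocalMap W 3 j (Sum.inr v₃) h →
            ∃ μ ∈ M, (φ h ⊗ₜ[ℚ] (1 : CyclotomicField (cycLevel 3 0 r) ℚ)) -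
                (((3 : ℕ) : ℤ_[3]) ^ (0 : ℕ)) • Λ 0 r y = (((3 : ℕ) : ℤ_[3]) ^ (j + 1)) • (μ : _)) :
    ∃ Λfin : ∀ j : ℕ, galoisCohomology
        ((W.torsionGaloisModule (((3 : ℕ) : ℤ) ^ j * ((3 : ℕ) : ℤ))).toLocal (Sum.inr v₃)) 1 →+
          ZMod (3 ^ (j + 1)),
      (∀ j : ℕ, KatoExpStarFiniteLevelAt W 3 j 0 v₃ Λ (Λfin j)) ∧
      (∀ (j : ℕ) (y : (tateLocalRep W 3 (Sum.inr v₃)).cohomology 1) (s : ℤ_[3]), φ y = s →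
        Λfin j (tateLocalMap W 3 j (Sum.inr v₃) y) = PadicInt.toZModPow (j + 1) s) := by
  obtain ⟨hint, hsurjφ⟩ := KimAtThreeFineKatoLemmaL.lemmaL_range_three W hadd hc ht v₃ φ hdual
  obtain ⟨Λfin, hI, hΛ⟩ :=
    KimAtThreeFineKatoLemmaL.exists_finLevelFunctional_clauses_three W hadd hc ht v₃ hv₃ φ hker hdual
  refine ⟨Λfin, fun j => ⟨(hI j).1, (hI j).2, ?_⟩, hΛ⟩
  -- clause (ii): the tame-level scalar compatibility, from the semi-local package and SAT₀
  intro r Ψ hΨ y κ₀ s hres hloc hval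
  obtain ⟨Λ₀, M, hΛ₀, hu, hM, hcompat⟩ := hsemi j r
  obtain ⟨h, hh⟩ := (mem_propagatedSelmerStructure_iff W 3 j (Sum.inr v₃) _).mp hloc
  obtain ⟨μ, hμ, he⟩ := hcompat Ψ hΨ y κ₀ h hres hh.symm
  set e : ℤ_[3] := ⟨φ h, hint h⟩ with hedef
  have hφe : φ h = (e : ℚ_[3]) := rfl
  rw [← hh, hΛ j h e hφe]
  rw [hφe] at he
  exact KimAtThreePortSharedSATCore.toZModPow_eq_of_rider_premise 3 (cycLevel 3 0 r) hΛ₀ hu hM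
    ⟨μ, hμ, he⟩ hval

/-- **The registered stub `stub_fineKato` of crux `KatoKuriharaPortThreeShared` (= the FINE KATO
PACKAGE ⟨C1⟩, signature VERBATIM as registered in `Cruxes/KatoKuriharaPortThreeShared/Lines/fineKato.lean`)
FROM ONE DISPLAYED «DEFINED-KATO PACKAGE» `hK` in which NO rider predicate and NO finite-level
functional appears any more**: per Kato-stratum row, `hK` supplies Kato's embeddings `ι`, constant `κ`,
value datum `Λ` and the `ℚ₃`-component `φ = exp*_ω` of `Λ` with — (R-κ) `κ ∈ ℚˣ`, `v₃(κ) = 0` ((C1.a),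
memo (a″) ⟸ `3 ∤ c_P`); the two ℚ₃-level PRINT facts `hker`/`hdual` for `φ` ([BK90] 3.8/3.11, Tate
duality); the SEMI-LOCAL package of `exists_katoExpStarFiniteLevelAt_of_semiLocal` for `(Λ, φ)` at every
depth and tame level (SAT₀'s E-side over `K_w`, [BK90] over `K_w`, exactness + restriction-compatibility
of a DEFINED `Λ`); and Kato's `ZetaBody` family for `(ι, κ, Λ)` (Kato-v2 = [Kato04] 8.1.3/8.12/9.7/6.6(1)/13.3
with `exp*` defined) — and THIS FILE constructs `Λfin` and proves the rider at every depth.  So the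
crux's residual reads: 19560 ⟸ ⟨C1⟩ ⟸ `hK` (objects: `exp*_ω` over `ℚ₃` and the `K_w`, the `K_w`
formal-group logarithm, Kato-v2), the rider clauses (i)/(ii) being KERNEL THEOREMS.  `hK` displayed;
closes nothing; nothing booked.
[cite: Kato2004Asterisque, (8.1.3) (p. 180), Prop. 8.12 (p. 186), §9.4 and Thm. 9.7 (pp. 188–189), Thm. 6.6 (1) (p. 163), Ex. 13.3 (pp. 224–225)]
[cite: BlochKato1990, §3 (Prop. 3.8, Ex. 3.11)] [cite: Kim2022StructureSelmer, §3.3–§3.4.1 and Thm. 3.13] -/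
theorem fineKato_of_definedKatoPackage
    (hK : ∀ (W : WeierstrassCurve ℚ) [W.IsElliptic] [W.IsGloballyMinimal]
      [ContinuousSMul ℤ_[3] (W.tateModule 3)] [Module.Free ℤ_[3] (W.tateModule 3)]
      [Module.Finite ℤ_[3] (W.tateModule 3)],
      (∀ m : ℕ, W.HasSurjectiveModNGaloisRep (3 ^ m : ℕ)) →
      (haveI : Fact (Nat.Prime 3) := ⟨Nat.prime_three⟩; Addv W 3) →
      ¬ 3 ∣ (W.baseChange ℚ_[3]).localTamagawaNumber ℤ_[3] →
      Nat.card {Q : (W.baseChange ℚ_[3]).toAffine.Point // (3 : ℕ) • Q = 0} = 1 →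
      ∀ (v₃ : HeightOneSpectrum (𝓞 ℚ)), ((3 : ℕ) : 𝓞 ℚ) ∈ v₃.asIdeal →
      ∀ {N : ℕ} [NeZero N] (P : ModularParametrizationData W N), N = W.conductorNorm ℤ →
        (∀ z ∈ P.L.lattice, ∃ w ∈ periodLattice P.f, z = P.c * w) →
        ¬ (3 : ℤ) ∣ P.maninConstant →
        ∃ (ι : (n : ℕ) → (CyclotomicField n ℚ →+* ℂ)) (κK : ℝ)
          (Λ : ∀ (k' : ℕ) (r : Finset (HeightOneSpectrum (𝓞 ℚ))),
            H1 (tateRep W 3) (cycSubgroup 3 k' r) →ₗ[ℤ_[3]]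
              ℚ_[3] ⊗[ℚ] CyclotomicField (cycLevel 3 k' r) ℚ)
          (φ : (tateLocalRep W 3 (Sum.inr v₃)).cohomology 1 →+ ℚ_[3]),
          κK ≠ 0 ∧ (∃ u : ℚ, (u : ℝ) = κK ∧ padicValRat 3 u = 0) ∧
          (∀ y, φ y = 0 ↔ ∀ j : ℕ, tateLocalMap W 3 j (Sum.inr v₃) y ∈
            W.kummerSelmerStructure (((3 : ℕ) : ℤ) ^ j * ((3 : ℕ) : ℤ)) (Sum.inr v₃)) ∧
          (∀ a : ℚ_[3], (∃ y, φ y = a) ↔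
            ∀ Q : (W.baseChange ℚ_[3]).toAffine.Point, ‖a * padicLog (W.baseChange ℚ_[3]) Q‖ ≤ 1) ∧
          (∀ (j : ℕ) (r : Finset (HeightOneSpectrum (𝓞 ℚ))),
          ∃ (Λ₀ : Set (ℚ_[3] ⊗[ℚ] CyclotomicField (cycLevel 3 0 r) ℚ))
            (M : Submodule ℤ_[3] (ℚ_[3] ⊗[ℚ] CyclotomicField (cycLevel 3 0 r) ℚ)),
            Λ₀ ⊆ cycIntLattice 3 (cycLevel 3 0 r) ∧
            (∃ ℓ ∈ Λ₀, ‖Algebra.trace ℚ_[3] (ℚ_[3] ⊗[ℚ] CyclotomicField (cycLevel 3 0 r) ℚ) ℓ‖ = 1) ∧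
            (∀ μ ∈ M, ∀ ℓ ∈ Λ₀,
              ‖Algebra.trace ℚ_[3] (ℚ_[3] ⊗[ℚ] CyclotomicField (cycLevel 3 0 r) ℚ) (μ * ℓ)‖ ≤ 1) ∧
            ∀ (Ψ : H1 (tateRep W 3) (cycSubgroup 3 0 r) →+
                continuousCohomology 1 (subgroupRep
                  (W.torsionGaloisModule (((3 : ℕ) : ℤ) ^ j * ((3 : ℕ) : ℤ))).toTopRep (cycSubgroup 3 0 r))),
              (∀ (φ' : contOneCocycles (subgroupRep (tateRep W 3).toTopRep (cycSubgroup 3 0 r)))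
                  (ψ : contOneCocycles (subgroupRep
                    (W.torsionGaloisModule (((3 : ℕ) : ℤ) ^ j * ((3 : ℕ) : ℤ))).toTopRep (cycSubgroup 3 0 r))),
                  (∀ g, ((ψ.1 g : geomTorsion W (((3 : ℕ) : ℤ) ^ j * ((3 : ℕ) : ℤ))) : geomPoints W) =
                    TateModule.proj 3 (j + 1) (φ'.1 g)) →
                  Ψ (oneCocycleClass _ φ') = oneCocycleClass _ ψ) →
              ∀ (y : H1 (tateRep W 3) (cycSubgroup 3 0 r))
                (κ₀ : galoisCohomology (W.torsionGaloisModule (((3 : ℕ) : ℤ) ^ j * ((3 : ℕ) : ℤ))) 1)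
                (h : (tateLocalRep W 3 (Sum.inr v₃)).cohomology 1),
                resSubgroup (W.torsionGaloisModule (((3 : ℕ) : ℤ) ^ j * ((3 : ℕ) : ℤ))).toTopRep
                    (cycSubgroup 3 0 r) 1 κ₀ = Ψ y →
                galoisCohomology.localization (W.torsionGaloisModule (((3 : ℕ) : ℤ) ^ j * ((3 : ℕ) : ℤ)))
                    (Sum.inr v₃) 1 κ₀ = tateLocalMap W 3 j (Sum.inr v₃) h →
                ∃ μ ∈ M, (φ h ⊗ₜ[ℚ] (1 : CyclotomicField (cycLevel 3 0 r) ℚ)) -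
                    (((3 : ℕ) : ℤ_[3]) ^ (0 : ℕ)) • Λ 0 r y = (((3 : ℕ) : ℤ_[3]) ^ (j + 1)) • (μ : _)) ∧
          ∀ (c d a : ℤ) (A : ℕ), 0 < A → Int.gcd c (6 * 3 * A) = 1 → Int.gcd d (6 * 3 * N) = 1 →
            ∃ (z : ∀ (k' : ℕ) (r : (cyclotomicLevelsRat 3 (badPlaces c d A N)).Ideals),
                  H1 (tateRep W 3) ((cyclotomicLevelsRat 3 (badPlaces c d A N)).level k' r.1))
              (x : ∀ (k' : ℕ) (r : (cyclotomicLevelsRat 3 (badPlaces c d A N)).Ideals),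
                  CyclotomicField (cycLevel 3 k' r.1) ℚ),
              ZetaBody W 3 P.f ι κK Λ c d a A z x) :
    ∀ (W : WeierstrassCurve ℚ) [W.IsElliptic] [W.IsGloballyMinimal]
      [ContinuousSMul ℤ_[3] (W.tateModule 3)] [Module.Free ℤ_[3] (W.tateModule 3)]
      [Module.Finite ℤ_[3] (W.tateModule 3)],
      (∀ m : ℕ, W.HasSurjectiveModNGaloisRep (3 ^ m : ℕ)) →
      (haveI : Fact (Nat.Prime 3) := ⟨Nat.prime_three⟩; Addv W 3) →
      ¬ 3 ∣ (W.baseChange ℚ_[3]).localTamagawaNumber ℤ_[3] →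
      Nat.card {Q : (W.baseChange ℚ_[3]).toAffine.Point // (3 : ℕ) • Q = 0} = 1 →
      ∀ (v₃ : HeightOneSpectrum (𝓞 ℚ)), ((3 : ℕ) : 𝓞 ℚ) ∈ v₃.asIdeal →
      ∀ {N : ℕ} [NeZero N] (P : ModularParametrizationData W N), N = W.conductorNorm ℤ →
        (∀ z ∈ P.L.lattice, ∃ w ∈ periodLattice P.f, z = P.c * w) →
        ¬ (3 : ℤ) ∣ P.maninConstant →
        ∃ (ι : (n : ℕ) → (CyclotomicField n ℚ →+* ℂ)) (κK : ℝ)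
          (Λ : ∀ (k' : ℕ) (r : Finset (HeightOneSpectrum (𝓞 ℚ))),
            H1 (tateRep W 3) (cycSubgroup 3 k' r) →ₗ[ℤ_[3]]
              ℚ_[3] ⊗[ℚ] CyclotomicField (cycLevel 3 k' r) ℚ)
          (Λfin : ∀ j : ℕ, galoisCohomology
            ((W.torsionGaloisModule (((3 : ℕ) : ℤ) ^ j * ((3 : ℕ) : ℤ))).toLocal (Sum.inr v₃)) 1 →+
              ZMod (3 ^ (j + 1))),
          κK ≠ 0 ∧ (∃ u : ℚ, (u : ℝ) = κK ∧ padicValRat 3 u = 0) ∧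
          (∀ j : ℕ, KatoExpStarFiniteLevelAt W 3 j 0 v₃ Λ (Λfin j)) ∧
          ∀ (c d a : ℤ) (A : ℕ), 0 < A → Int.gcd c (6 * 3 * A) = 1 → Int.gcd d (6 * 3 * N) = 1 →
            ∃ (z : ∀ (k' : ℕ) (r : (cyclotomicLevelsRat 3 (badPlaces c d A N)).Ideals),
                  H1 (tateRep W 3) ((cyclotomicLevelsRat 3 (badPlaces c d A N)).level k' r.1))
              (x : ∀ (k' : ℕ) (r : (cyclotomicLevelsRat 3 (badPlaces c d A N)).Ideals),
                  CyclotomicField (cycLevel 3 k' r.1) ℚ),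
              ZetaBody W 3 P.f ι κK Λ c d a A z x := by
  intro W _ _ _ _ _ htow hadd hc ht v₃ hv₃ N _ P hN hlat hman
  obtain ⟨ι, κK, Λ, φ, hκ0, hκu, hker, hdual, hsemi, hz⟩ := hK W htow hadd hc ht v₃ hv₃ P hN hlat hman
  obtain ⟨Λfin, hrider, -⟩ :=
    exists_katoExpStarFiniteLevelAt_of_semiLocal W hadd hc ht v₃ hv₃ φ hker hdual Λ hsemi
  exact ⟨ι, κK, Λ, Λfin, hκ0, hκu, hrider, hz⟩

end Summit.BirchSwinnertonDyer.BirchSwinnertonDyer.Theorems.KimAtThreeFineKatoRiderAssembly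

end
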